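import Literature.Computability.Complexity.RowSelectFP
import Literature.Computability.Cryptography.SISOddPartMachine
import Literature.Algebra.EuclideanLattices.SimultaneousApproximationLLLProofs
import Literature.Computability.Cryptography.RegevDGSReduction
import HarnessLib

/-!
# Regev 2009, Lemma 3.17 at machine level, I: the classical post-processor of the `GIVP ≤ DGS` machine (`FP`)

Topic `Computability/Cryptography` (family `pqc`), grouping namespace `Regev2009.GIVPPost`. The
machine realising hypothesis `h₃` (= Regev's **Lemma 3.17**, `GIVP_{2√n φ} ≤ DGS_φ`) of the proved
assembly `regev_lwe_to_sivp_quantum_of_worstCase` (`RegevDGSReductionWorstCase.lean`) of the named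
fact `Literature.Computability.Cryptography.regev_lwe_to_sivp_quantum` (pqc.S19) is a classical wrap
(`QuantumComplexity/CWrap*.lean`) around polynomially many indexed parallel copies
(`QuantumComplexity/PolyCopiesIdx*.lean`) of the given quantum `DGS` sampler. This file is its
classical POST-PROCESSOR as ONE polynomial-time string function on `⟨code of the instance B, Y⟩`
(`Y` the measured output string of the copies family), written in the typed `FP` algebra `CodeFP`:

* reading the instance: `dim`, `basisRows` (the rows of `B` as lists), the LLL basis (the tree's
  `SimApproxLLL.lllOut`/`lllOutFP`/`lllOut_spec`: the `FP` LLL machine `LLLMachine.lllMachineF`,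
  LLL82 Prop. 1.26; on nonsingular instances an LLL-reduced basis of the same lattice);
* reading the answers: copy `j` of the copies family with layout polynomials `(pF, pK)` occupies
  the wires from `base + j·b` on (`PolyCopiesIdx.blk`), and a classically wrapped block writes a
  SELF-DELIMITED code at the front of its segment, so the `j`-th answer is read as
  `fstF (Y ⇂ (base + j b))` and decoded EXACTLY as the tree's total decoder does
  (`readVec n u = List.ofFn (decodeIntVec n u)`, via the closed form `SIS.OddPartFP.decodeIntVec_eq`
  and the canonical re-encoding `SIS.OddPartFP.canonIV`); the answers are grouped `n²` at a time
  (group `g` = the `n²` copies that queried the `g`-th radius);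
* the selection `RowSelect.post detZ n B B_LLL groups` of `LinearAlgebra/Matrix/RowLatticeSelection.lean`
  (Cramer membership, Gram-determinant independence, greedy selection, shortest set found — Regev's
  "look for a set of `n` linearly independent vectors in each `Sᵢ` and output the shortest set
  found", with the LLL basis as the fallback "`S` is already shorter than `2√n φ(L)`"), run in
  polynomial time by `RowSelectFP.post_codeFP`;
* the output `⟨listE smE (flattened rows), ε⟩`, which the tree's `decodeIntMatrix n` reads back
  (`decodeIntMatrix_postStr`).

Main results: **`postStr_codeFP`** (`CodeFP (pairE instE strE) strE (postStr pF pK)`), hence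
**`exists_postFn`** (`∃ g ∈ FP, ∀ I Y, g ⟨encode I, Y⟩ = postStr pF pK (I, Y)`), and the semantic
lemmas `readVec_eq_ofFn_decodeIntVec`, `decodeIntMatrix_postStr`
consumed by the assembly of the machine (sequel file).

## References

* O. Regev, *On lattices, learning with errors, random linear codes, and cryptography*, J. ACM 56
  (2009), art. 34, Lemma 3.17 (proof, p. 21 of arXiv:2401.03703) [Regev2009].
* A. K. Lenstra, H. W. Lenstra, L. Lovász, *Factoring polynomials with rational coefficients*,
  Math. Ann. 261 (1982), Prop. 1.26 [LenstraLenstraLovasz1982].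
* [AroraBarak2009] S. Arora, B. Barak, *Computational Complexity: A Modern Approach*, CUP 2009,
  §0.1, §1.3.
-/

noncomputable section

namespace Literature.Computability.Cryptography

namespace Regev2009.GIVPPost

open _root_.Computability Polynomial Literature.Computability.Complexity
  Literature.Computability.Complexity.CodeFP Literature.Computability.Complexity.Brick
  Literature.LinearAlgebra.Matrix Literature.LinearAlgebra.Matrix.Berkowitz
  Literature.LinearAlgebra.Matrix.RowSelect Literature.Computability.Complexity.IntDetFP
  Literature.Algebra.EuclideanLattices SIS.OddPartFP NegCNF

/-! ### Encoders -/

/-- Lattice instances by their tree code. [folklore] -/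
abbrev instE : LatticeInstance → List Bool := LatticeInstance.encode

/-- Integer vectors: raw lists of canonical integer codes. -/
local notation "ivecE" => rawE intE

/-- Integer matrices: raw lists of rows. -/
local notation "zmatE" => rawE (rawE intE)

/-! ### The instance: dimension, rows, the LLL basis -/

/-- The rows of the basis of an instance, as lists. [folklore] -/
def basisRows (I : LatticeInstance) : List (List ℤ) := rows I.basis

/-- The flat row-major entry list. [folklore] -/
def flat (I : LatticeInstance) : List ℤ := (basisRows I).flatten

/-- **The shape of the code of an instance** in `CodeFP` encoders: `⟨bin n, listE smE (flat entries)⟩`.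
[cite: AroraBarak2009, §0.1] -/
theorem flat_eq_ofFn_flatEntries (I : LatticeInstance) :
    flat I = List.ofFn (LLLMachine.flatEntries (show Fin I.n → Fin I.n → ℤ from I.basis)) := by
  have h := LLLMachine.ofFn_flatEntries (show Fin I.n → Fin I.n → ℤ from I.basis) id
  rw [flat, basisRows, rows]
  exact h.symm

/-- The flat list has `n²` entries. [folklore] -/
theorem length_flat (I : LatticeInstance) : (flat I).length = I.n * I.n := by
  rw [flat, basisRows, rows]
  exact LLLMachine.length_flatten_ofFn (fun i j => I.basis i j)

/-- **The shape of the code of an instance** in `CodeFP` encoders: `⟨bin n, listE smE (flat entries)⟩`.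
[cite: AroraBarak2009, §0.1] -/
theorem encode_eq_pairE (I : LatticeInstance) : I.encode = pairE natE (listE smE) (I.n, flat I) := by
  rw [LLLMachine.encode_eq_record, pairE_apply, listE, length_flat, flat_eq_ofFn_flatEntries]
  rfl

/-- A list of rows of length `n` is the list of the consecutive windows of length `n` of its
flattening. [folklore] -/
theorem eq_windows_of_forall_length {α : Type} {n : ℕ} :
    ∀ T : List (List α), (∀ r ∈ T, r.length = n) →
      T = (List.range T.length).map fun i => (T.flatten.drop (i * n)).take n
  | [], _ => rfl
  | r :: T, h => by
    have hr : r.length = n := h r List.mem_cons_self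
    have ih := eq_windows_of_forall_length T fun r' hr' => h r' (List.mem_cons_of_mem r hr')
    rw [List.length_cons, List.range_succ_eq_map, List.map_cons, List.map_map, List.flatten_cons]
    congr 1
    · rw [zero_mul, List.drop_zero, List.take_left' hr]
    · conv_lhs => rw [ih]
      refine List.map_congr_left fun i _ => ?_
      rw [Function.comp_apply, Nat.succ_mul, show i * n + n = r.length + i * n by omega, List.drop_append,
        List.drop_eq_nil_of_le (Nat.le_add_right r.length (i * n)), List.nil_append, Nat.add_sub_cancel_left]

/-- The rows are the `n` consecutive windows of length `n` of the flat list. [folklore] -/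
theorem basisRows_eq_windows (I : LatticeInstance) :
    basisRows I = (List.range I.n).map fun i => ((flat I).drop (i * I.n)).take I.n := by
  have h := eq_windows_of_forall_length (n := I.n) (basisRows I) (fun r hr => by
    rw [basisRows, rows, List.mem_ofFn] at hr
    obtain ⟨i, rfl⟩ := hr
    simp)
  rwa [show (basisRows I).length = I.n by rw [basisRows, length_rows]] at h

/-- Transport of a `CodeFP` statement on `(n, flat)` to the instance code. [folklore] -/
theorem codeFP_of_pair {β : Type} {eβ : β → List Bool} {g : ℕ × List ℤ → β}
    (h : CodeFP (pairE natE (listE smE)) eβ g) : CodeFP instE eβ (fun I => g (I.n, flat I)) := by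
  obtain ⟨f, hf, hfg⟩ := h
  exact ⟨f, hf, fun I => by rw [show instE I = _ from encode_eq_pairE I, hfg]⟩

/-- **The dimension on codes.** [cite: AroraBarak2009, §1.3] -/
theorem dim_codeFP : CodeFP instE natE (fun I => I.n) := codeFP_of_pair (fst natE (listE smE))

/-- Lists with a unary header: the length is the header. [folklore] -/
theorem listLength_codeFP : CodeFP (listE smE) unE List.length := (ulength smE).comp (rawOfList smE)

/-- Lists with a unary header, items re-encoded canonically. [folklore] -/
theorem listItems_codeFP : CodeFP (listE smE) (rawE intE) id :=
  ((map₀ intOfSM).comp (rawOfList smE)).congr fun l => by simp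

/-- **The flat entry list on codes.** [cite: AroraBarak2009, §1.3] -/
theorem flat_codeFP : CodeFP instE ivecE flat := codeFP_of_pair (listItems_codeFP.comp (snd natE (listE smE)))

/-- **The dimension in unary** (`n = min n n²`, the unary header capping the conversion). [cite: AroraBarak2009, §1.3] -/
theorem unDim_codeFP : CodeFP instE unE (fun I => I.n) := by
  have h : CodeFP (pairE natE (listE smE)) unE (fun p => min p.1 p.2.length) :=
    (unOfNatMin.comp ((listLength_codeFP.comp (snd natE (listE smE))).pair (fst natE (listE smE)))).congr fun _ => rfl
  refine (codeFP_of_pair h).congr fun I => ?_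
  rw [length_flat]
  rcases Nat.eq_zero_or_pos I.n with h0 | hpos
  · rw [h0]; rfl
  · exact min_eq_left (Nat.le_mul_of_pos_left I.n hpos)

/-- **The basis rows on codes** (the `n` windows of the flat list). [cite: AroraBarak2009, §1.3] -/
theorem basisRows_codeFP : CodeFP instE zmatE basisRows := by
  -- context `(1ⁿ, flat)`, item `i` (binary)
  let cE := pairE unE ivecE
  have qn : CodeFP (pairE cE natE) unE (fun t => t.1.1) := (fst _ _).fst'
  have qf : CodeFP (pairE cE natE) ivecE (fun t => t.1.2) := (fst _ _).snd'
  have qi : CodeFP (pairE cE natE) natE (fun t => t.2) := snd _ _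
  have hoff : CodeFP (pairE cE natE) natE (fun t => t.2 * t.1.1) := (natMul.comp (qi.pair (natOfUn.comp qn))).congr fun _ => rfl
  have hcap : CodeFP (pairE cE natE) unE (fun t => min (t.2 * t.1.1) t.1.2.length) :=
    (unOfNatMin.comp (((ulength intE).comp qf).pair hoff)).congr fun _ => rfl
  have hdrop : CodeFP (pairE cE natE) ivecE (fun t => t.1.2.drop (min (t.2 * t.1.1) t.1.2.length)) :=
    ((rawDropUn intE).comp (hcap.pair qf)).congr fun _ => rfl
  have hwin : CodeFP (pairE cE natE) ivecE (fun t => (t.1.2.drop (min (t.2 * t.1.1) t.1.2.length)).take t.1.1) :=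
    ((rawTakeUn intE).comp (qn.pair hdrop)).congr fun _ => rfl
  have hmap := map (σ := ℕ × List ℤ) (eσ := cE) (eα := natE) hwin
  have hctx : CodeFP instE (pairE cE (rawE natE)) (fun I => ((I.n, flat I), List.range I.n)) :=
    ((unDim_codeFP.pair flat_codeFP).pair (urange.comp unDim_codeFP)).congr fun _ => rfl
  refine (hmap.comp hctx).congr fun I => ?_
  rw [basisRows_eq_windows]
  refine List.map_congr_left fun i _ => ?_
  simp only [drop_min_length]

/-! ### The LLL basis -/

/- The output of the tree's LLL machine on an instance is the tree's `SimApproxLLL.lllOut`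
(`SimultaneousApproximationLLLProofs.lean`: `lllOutFP`, and `lllOut_spec` — on a nonsingular instance an
LLL-reduced basis of the same lattice, LLL82 Prop. 1.26 via `exists_lllMachineF_encode_eq`). -/

/-- **The rows of the LLL basis on codes.** [cite: LenstraLenstraLovasz1982, Prop. 1.26] -/
theorem lllRows_codeFP : CodeFP instE zmatE (fun I => basisRows (SimApproxLLL.lllOut I)) :=
  basisRows_codeFP.comp SimApproxLLL.lllOutFP

/-! ### Reading a vector exactly as the tree's total decoder does -/

/-- `entriesOf k w` has `k` entries. [folklore] -/
@[simp] theorem length_entriesOf (k : ℕ) (w : List Bool) : (entriesOf k w).length = k := by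
  simp [entriesOf]

/-- **The vector read off a string**, for dimension `n`: the entries if both headers announce `n`,
else `0ⁿ` — the list form of the tree's `decodeIntVec n` (`readVec_eq_ofFn_decodeIntVec`).
[cite: AroraBarak2009, §0.1 (representations)] -/
def readVec (n : ℕ) (u : List Bool) : List ℤ :=
  if hdrOf u = n ∧ lenOf u = n then entriesOf n u else List.replicate n 0

/-- `readVec n u` has length `n`. [folklore] -/
theorem length_readVec (n : ℕ) (u : List Bool) : (readVec n u).length = n := by
  rw [readVec]
  split_ifs
  · exact length_entriesOf _ _
  · exact List.length_replicate

/-- **`readVec` is the tree's decoder**: `readVec n u = List.ofFn (decodeIntVec n u)`. [cite: AroraBarak2009, §0.1] -/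
theorem readVec_eq_ofFn_decodeIntVec (n : ℕ) (u : List Bool) : readVec n u = List.ofFn (decodeIntVec n u) := by
  rw [readVec, decodeIntVec_eq]
  split_ifs with h
  · apply List.ext_getElem (by simp [entriesOf])
    intro i h₁ h₂
    rw [List.getElem_ofFn, List.getD_eq_getElem]
  · rw [Pi.zero_def, List.ofFn_const]

/-- The canonical re-encoding on codes: `u ↦ (hdrOf u, entriesOf (lenOf u) u)`. [cite: AroraBarak2009, §1.3] -/
theorem canon_codeFP : CodeFP strE (pairE natE (listE smE)) (fun u => (hdrOf u, entriesOf (lenOf u) u)) :=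
  ⟨canonIV, canonIV_mem_FP, fun u => by
    dsimp only
    rw [canonIV_apply, pairE_apply, listE, length_entriesOf]
    rfl⟩

/-- **`readVec` on codes** (dimension in unary). [cite: AroraBarak2009, §1.3] -/
theorem readVec_codeFP : CodeFP (pairE unE strE) ivecE (fun p => readVec p.1 p.2) := by
  let iE := pairE unE strE
  have pn : CodeFP iE unE (fun p => p.1) := fst _ _
  have pnN : CodeFP iE natE (fun p => p.1) := (natOfUn.comp pn).congr fun _ => rfl
  have hc : CodeFP iE (pairE natE (listE smE)) (fun p => (hdrOf p.2, entriesOf (lenOf p.2) p.2)) := (canon_codeFP.comp (snd _ _)).congr fun _ => rfl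
  have hhdr : CodeFP iE natE (fun p => hdrOf p.2) := hc.fst'
  have hes : CodeFP iE ivecE (fun p => entriesOf (lenOf p.2) p.2) := (listItems_codeFP.comp hc.snd').congr fun _ => rfl
  have hlen : CodeFP iE natE (fun p => (entriesOf (lenOf p.2) p.2).length) := ((natLength intE).comp hes).congr fun _ => rfl
  have hcond : CodeFP iE bitE (fun p => decide (hdrOf p.2 = p.1) && decide ((entriesOf (lenOf p.2) p.2).length = p.1)) :=
    ((natEq.comp (hhdr.pair pnN)).and (natEq.comp (hlen.pair pnN))).congr fun _ => rfl
  have hzero : CodeFP iE ivecE (fun p => List.replicate p.1 (0 : ℤ)) := ((replicateOf intE).comp ((const _ (0 : ℤ)).pair pn)).congr fun _ => rfl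
  refine (hcond.ite hes hzero).congr fun p => ?_
  rw [readVec, length_entriesOf]
  by_cases h : hdrOf p.2 = p.1 ∧ lenOf p.2 = p.1
  · rw [if_pos h, if_pos (by simp [h.1, h.2]), h.2]
  · rw [if_neg h, if_neg (by simpa [Bool.and_eq_true, decide_eq_true_iff] using h)]

/-! ### The layout of the copies and the answers -/

variable (pF pK : Polynomial ℕ)

/-- The number of copies on copies-inputs of length `m` (`PolyCopiesIdx.K`). [folklore] -/
def Kof (m : ℕ) : ℕ := pK.eval m + 1

/-- The input length of a copy (`PolyCopiesIdx.nIn`). [folklore] -/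
def nInOf (m : ℕ) : ℕ := m + Kof pK m

/-- The block width (`PolyCopiesIdx.b`). [folklore] -/
def bOf (m : ℕ) : ℕ := nInOf pK m + pF.eval (nInOf pK m) + 2

/-- The first wire of the blocks (`PolyCopiesIdx.base`). [folklore] -/
def baseOf (m : ℕ) : ℕ := bOf pF pK m + 1

/-- The length of the copies-input made from an instance: `|⟨encode I, ε⟩| = 2 |encode I| + 2`. [folklore] -/
def inLen (I : LatticeInstance) : ℕ := 2 * I.encode.length + 2

/-- **The `j`-th answer**: the vector read off the first self-delimited component of `Y` from wire
`base + j b` on. [cite: Regev2009, Lemma 3.17 (proof: the sets Sᵢ of oracle answers)] -/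
def candVec (I : LatticeInstance) (Y : List Bool) (j : ℕ) : List ℤ :=
  readVec I.n (boolUnpair (Y.drop (baseOf pF pK (inLen I) + j * bOf pF pK (inLen I)))).1

/-- **The groups of answers**: group `g` lists the answers of the copies `g n², …, g n² + n² - 1`
(the copies that queried the `g`-th radius). [cite: Regev2009, Lemma 3.17 (proof)] -/
def groupsOf (I : LatticeInstance) (Y : List Bool) : List (List (List ℤ)) :=
  (List.range (Kof pK (inLen I) / (I.n * I.n))).map fun g =>
    (List.range (I.n * I.n)).map fun t => candVec pF pK I Y (g * (I.n * I.n) + t)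

/-- **The selected vectors**: Regev's selection over the groups, with the LLL basis as fallback.
[cite: Regev2009, Lemma 3.17 (proof)] -/
def postOut (I : LatticeInstance) (Y : List Bool) : List (List ℤ) :=
  post detZ I.n (basisRows I) (basisRows (SimApproxLLL.lllOut I)) (groupsOf pF pK I Y)

/-- **The output string of the post-processor**: `⟨listE smE (flattened selection), ε⟩`.
[cite: Regev2009, Lemma 3.17 (proof)] -/
def postStr (p : LatticeInstance × List Bool) : List Bool :=
  boolPair (listE smE (postOut pF pK p.1 p.2).flatten) []

/-- Evaluation of a polynomial at a unary numeral, in unary. [cite: AroraBarak2009, §1.3] -/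
theorem polyEval_codeFP (Q : Polynomial ℕ) : CodeFP unE unE (fun m => Q.eval m) :=
  ⟨Plumb.polyFn Q, Plumb.polyFn_mem_FP Q, fun m => by rw [Plumb.polyFn_apply, length_unE, unE_eq_ones]⟩

/-- `Kof` in unary. [folklore] -/
theorem Kof_codeFP : CodeFP unE unE (Kof pK) := unSucc.comp (polyEval_codeFP pK)

/-- `nInOf` in unary. [folklore] -/
theorem nInOf_codeFP : CodeFP unE unE (nInOf pK) := unAdd.comp ((CodeFP.id unE).pair (Kof_codeFP pK))

/-- `bOf` in unary. [folklore] -/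
theorem bOf_codeFP : CodeFP unE unE (bOf pF pK) :=
  unSucc.comp (unSucc.comp (unAdd.comp ((nInOf_codeFP pK).pair ((polyEval_codeFP pF).comp (nInOf_codeFP pK)))))

/-- `baseOf` in unary. [folklore] -/
theorem baseOf_codeFP : CodeFP unE unE (baseOf pF pK) := unSucc.comp (bOf_codeFP pF pK)

/-- `inLen` in unary. [folklore] -/
theorem inLen_codeFP : CodeFP instE unE inLen := by
  have hL : CodeFP instE unE (fun I => I.encode.length) := ⟨onesFn, onesFn_mem_FP, fun _ => rfl⟩
  exact (unSucc.comp (unSucc.comp (unAdd.comp (hL.pair hL)))).congr fun I => by simp only [inLen]; omega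

/-- The first component of a string (the brick `fstF`). [folklore] -/
theorem fstStr_codeFP : CodeFP strE strE (fun w => (boolUnpair w).1) := ⟨fstF, fstF_mem_FP, fun _ => rfl⟩

/-- The context of the answer reader: `(1ⁿ, Y, bin base, bin b)`. -/
local notation "ansCtxE" => pairE unE (pairE strE (pairE natE natE))

/-- **The answer reader on codes**: `((1ⁿ, Y, base, b), j) ↦ readVec n (fstF (Y ⇂ (base + j b)))`
(the offset capped at `|Y|` before the unary conversion). [cite: AroraBarak2009, §1.3] -/
theorem answer_codeFP :
    CodeFP (pairE ansCtxE natE) ivecE (fun t => readVec t.1.1 (boolUnpair (t.1.2.1.drop (t.1.2.2.1 + t.2 * t.1.2.2.2))).1) := by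
  let tE := pairE ansCtxE natE
  have qn : CodeFP tE unE (fun t => t.1.1) := (fst _ _).fst'
  have qY : CodeFP tE strE (fun t => t.1.2.1) := (fst _ _).snd'.fst'
  have qbase : CodeFP tE natE (fun t => t.1.2.2.1) := (fst _ _).snd'.snd'.fst'
  have qb : CodeFP tE natE (fun t => t.1.2.2.2) := (fst _ _).snd'.snd'.snd'
  have qj : CodeFP tE natE (fun t => t.2) := snd _ _
  have hoff : CodeFP tE natE (fun t => t.1.2.2.1 + t.2 * t.1.2.2.2) := (natAdd.comp (qbase.pair (natMul.comp (qj.pair qb)))).congr fun _ => rfl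
  have hcap : CodeFP tE unE (fun t => min (t.1.2.2.1 + t.2 * t.1.2.2.2) t.1.2.1.length) :=
    (unOfNatMin.comp ((strLength.comp qY).pair hoff)).congr fun _ => rfl
  have hdrop : CodeFP tE strE (fun t => t.1.2.1.drop (min (t.1.2.2.1 + t.2 * t.1.2.2.2) t.1.2.1.length)) :=
    (strDrop.comp (hcap.pair qY)).congr fun _ => rfl
  have h := readVec_codeFP.comp (qn.pair (fstStr_codeFP.comp hdrop))
  refine h.congr fun t => ?_
  simp only [drop_min_length]

/-- The answer context of an instance and an output string. [folklore] -/
def ansCtx (I : LatticeInstance) (Y : List Bool) : ℕ × List Bool × ℕ × ℕ :=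
  (I.n, Y, baseOf pF pK (inLen I), bOf pF pK (inLen I))

/-- The answer context on codes. [folklore] -/
theorem ansCtx_codeFP : CodeFP (pairE instE strE) ansCtxE (fun p => ansCtx pF pK p.1 p.2) := by
  have h1 := unDim_codeFP.comp (fst instE strE)
  have h3 := natOfUn.comp ((baseOf_codeFP pF pK).comp (inLen_codeFP.comp (fst instE strE)))
  have h4 := natOfUn.comp ((bOf_codeFP pF pK).comp (inLen_codeFP.comp (fst instE strE)))
  exact (h1.pair ((snd instE strE).pair (h3.pair h4))).congr fun _ => rfl

/-- **The groups of answers on codes** (two nested maps over unary-sized ranges). [cite: AroraBarak2009, §1.3] -/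
theorem groupsOf_codeFP : CodeFP (pairE instE strE) (rawE zmatE) (fun p => groupsOf pF pK p.1 p.2) := by
  let iE := pairE instE strE
  -- sizes
  have hK : CodeFP iE unE (fun p => Kof pK (inLen p.1)) := ((Kof_codeFP pK).comp (inLen_codeFP.comp (fst _ _))).congr fun _ => rfl
  have hn : CodeFP iE natE (fun p => p.1.n) := (dim_codeFP.comp (fst _ _)).congr fun _ => rfl
  have hnn : CodeFP iE natE (fun p => p.1.n * p.1.n) := (natMul.comp (hn.pair hn)).congr fun _ => rfl
  have hnnU : CodeFP iE unE (fun p => (flat p.1).length) := ((ulength intE).comp (flat_codeFP.comp (fst _ _))).congr fun _ => rfl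
  have hG : CodeFP iE natE (fun p => Kof pK (inLen p.1) / (p.1.n * p.1.n)) := (natDiv.comp ((natOfUn.comp hK).pair hnn)).congr fun _ => rfl
  have hGU : CodeFP iE unE (fun p => min (Kof pK (inLen p.1) / (p.1.n * p.1.n)) (Kof pK (inLen p.1))) :=
    (unOfNatMin.comp (hK.pair hG)).congr fun _ => rfl
  -- inner map: context `(ansCtx, g, n²)`, item `t`
  let cE := pairE ansCtxE (pairE natE natE)
  have hinner : CodeFP (pairE cE natE) ivecE
      (fun t => readVec t.1.1.1 (boolUnpair (t.1.1.2.1.drop (t.1.1.2.2.1 + (t.1.2.1 * t.1.2.2 + t.2) * t.1.1.2.2.2))).1) :=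
    (answer_codeFP.comp ((fst cE natE).fst'.pair (natAdd.comp ((natMul.comp ((fst cE natE).snd'.fst'.pair
      (fst cE natE).snd'.snd')).pair (snd cE natE))))).congr fun _ => rfl
  have hmapIn := map (σ := (ℕ × List Bool × ℕ × ℕ) × ℕ × ℕ) (eσ := cE) (eα := natE) hinner
  -- outer map: context `(ansCtx, n², range n²)`, item `g`
  let oE := pairE ansCtxE (pairE natE (rawE natE))
  have houterItem : CodeFP (pairE oE natE) (rawE ivecE)
      (fun t => t.1.2.2.map fun x => readVec t.1.1.1
        (boolUnpair (t.1.1.2.1.drop (t.1.1.2.2.1 + (t.2 * t.1.2.1 + x) * t.1.1.2.2.2))).1) :=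
    (hmapIn.comp ((((fst oE natE).fst').pair ((snd oE natE).pair (fst oE natE).snd'.fst')).pair
      (fst oE natE).snd'.snd')).congr fun _ => rfl
  have hmapOut := map (σ := (ℕ × List Bool × ℕ × ℕ) × ℕ × List ℕ) (eσ := oE) (eα := natE) houterItem
  have hRn : CodeFP iE (rawE natE) (fun p => List.range (flat p.1).length) := (urange.comp hnnU).congr fun _ => rfl
  have hRg : CodeFP iE (rawE natE) (fun p => List.range (min (Kof pK (inLen p.1) / (p.1.n * p.1.n)) (Kof pK (inLen p.1)))) :=
    (urange.comp hGU).congr fun _ => rfl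
  have hctx : CodeFP iE (pairE oE (rawE natE))
      (fun p => ((ansCtx pF pK p.1 p.2, p.1.n * p.1.n, List.range (flat p.1).length),
        List.range (min (Kof pK (inLen p.1) / (p.1.n * p.1.n)) (Kof pK (inLen p.1))))) :=
    ((ansCtx_codeFP pF pK).pair (hnn.pair hRn)).pair hRg
  refine (hmapOut.comp hctx).congr fun p => ?_
  rw [groupsOf, min_eq_left (Nat.div_le_self _ _), length_flat]
  rfl

/-- **The selected vectors on codes.** [cite: Regev2009, Lemma 3.17 (proof)] [cite: AroraBarak2009, §1.3] -/
theorem postOut_codeFP : CodeFP (pairE instE strE) zmatE (fun p => postOut pF pK p.1 p.2) := by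
  have h := RowSelectFP.post_codeFP.comp ((dim_codeFP.comp (fst instE strE)).pair
    ((basisRows_codeFP.comp (fst instE strE)).pair ((lllRows_codeFP.comp (fst instE strE)).pair (groupsOf_codeFP pF pK))))
  exact h.congr fun _ => rfl

/-- **The post-processor of Regev's `GIVP ≤ DGS` machine is ONE polynomial-time string function.**
[cite: Regev2009, Lemma 3.17 (proof)] [cite: AroraBarak2009, §1.3] -/
theorem postStr_codeFP : CodeFP (pairE instE strE) strE (postStr pF pK) := by
  have hflat : CodeFP (pairE instE strE) ivecE (fun p => (postOut pF pK p.1 p.2).flatten) :=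
    ((flatten intE).comp (postOut_codeFP pF pK)).congr fun _ => rfl
  have hsm : CodeFP (pairE instE strE) (listE smE) (fun p => (postOut pF pK p.1 p.2).flatten) :=
    ((listOfRaw smE).comp ((map₀ smOfInt).comp hflat)).congr fun p => List.map_id _
  exact (hsm.pair (const (pairE instE strE) (eβ := strE) ([] : List Bool))).recodeOut fun _ => rfl

/-- **The post-processor as an `FP` string function on `⟨encode I, Y⟩`.** [cite: Regev2009, Lemma 3.17 (proof)] -/
theorem exists_postFn : ∃ g : List Bool → List Bool, g ∈ FP ∧
    ∀ (I : LatticeInstance) (Y : List Bool), g (boolPair I.encode Y) = postStr pF pK (I, Y) := by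
  obtain ⟨g, hg, h⟩ := postStr_codeFP pF pK
  exact ⟨g, hg, fun I Y => h (I, Y)⟩

/-! ### Reading the output back -/

/-- `⟨a, ε⟩` followed by anything is `⟨a, that⟩`. [folklore] -/
theorem boolPair_nil_append (a r : List Bool) : boolPair a [] ++ r = boolPair a r := by
  simp [boolPair]

/-- The matrix code is the `listE smE` code of the flattened rows. [cite: AroraBarak2009, §0.1] -/
theorem encode_matrix_eq (n : ℕ) (C : Matrix (Fin n) (Fin n) ℤ) :
    (encodingIntMatrixFin n).encode C = listE smE (rows C).flatten := by
  have h1 : (⟨n, C⟩ : LatticeInstance).encode = boolPair (encodeNat n) ((encodingIntMatrixFin n).encode C) := by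
    rw [LatticeInstance.encode_eq, boolPair_encodeNat]
  have h2 := encode_eq_pairE ⟨n, C⟩
  rw [h1, pairE_apply] at h2
  have := boolPair_injective (show Function.uncurry boolPair (_, _) = Function.uncurry boolPair (_, _) from h2)
  rw [Prod.mk.injEq] at this
  exact this.2

/-- **The tree's reader recovers the selection**: if the selected rows are the rows of a matrix
`C`, every register whose content starts with the output string decodes (`decodeIntMatrix n`,
prefix-tolerant) to `C`. [cite: Regev2009, Lemma 3.17 (proof)] -/
theorem decodeIntMatrix_postStr {I : LatticeInstance} {Y : List Bool} {C : Matrix (Fin I.n) (Fin I.n) ℤ}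
    (hC : postOut pF pK I Y = rows C) {z : List Bool} (hz : postStr pF pK (I, Y) <+: z) :
    decodeIntMatrix I.n z = C := by
  obtain ⟨r, rfl⟩ := hz
  rw [postStr, boolPair_nil_append, hC, ← encode_matrix_eq, decodeIntMatrix_boolPair]

end Regev2009.GIVPPost

end Literature.Computability.Cryptography

end
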